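import Literature.Topology.FourManifolds.WhitneyModelSheets
import Mathlib.Geometry.Manifold.LocalDiffeomorph
import HarnessLib

/-!
# An injective immersion of a closed manifold into a connected one is a diffeomorphism

Stub `stub_compactModelRecognition` of line `ancient-sphere-rigidity` for the crux
`EntropyRung.SubcylindricalRecognition` (stmt-SmoothPoincare4-10869): the classical
differential-topology step which turns the injective immersion `S → M` of the compact blow-down
shrinker `S` into the closed connected `4`-manifold `M` (delivered by smooth Cheeger–Gromov
convergence) into a diffeomorphism `S ≅ M`.

## What

* `isLocalDiffeomorph_of_contMDiff_of_injective_mfderiv`: a `C^n` map (`1 ≤ n`) between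
  boundaryless manifolds of the same finite dimension all of whose differentials are injective
  is a `C^n` local diffeomorphism (inverse function theorem, in the tree's form
  `Literature.Topology.FourManifolds.isLocalDiffeomorphAt_of_mfderiv_injective`);
* `surjective_of_isOpenMap_of_compactSpace`: a continuous open map from a non-empty compact
  space to a connected Hausdorff space is onto (its range is clopen and non-empty);
* `nonempty_diffeomorph_of_injective_immersion`: model-agnostic form of the stub — an injective
  `C^n` immersion (`1 ≤ n`) of a non-empty compact manifold into a connected Hausdorff manifold
  of the same finite dimension is a diffeomorphism (Mathlib's
  `IsLocalDiffeomorph.diffeomorphOfBijective`);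
* `stub_compactModelRecognition`: the registered signature (models `EuclideanSpace ℝ (Fin 4)`,
  `𝓡 4`, smoothness `∞`).

## Proof (fact-free)

Lee, *Introduction to Smooth Manifolds*, 2nd ed.: an injective linear map between spaces of
equal finite dimension is an isomorphism, so by the inverse function theorem (Thm. 4.5) `φ` is a
local diffeomorphism (Prop. 4.8), hence open; `φ(N)` is compact, hence closed in the Hausdorff
`M`, open, and non-empty, hence all of the connected `M` (Thm. 4.29 / Prop. 4.8(b)); a bijective
local diffeomorphism is a diffeomorphism (Prop. 4.6 / Thm. 4.14).

## References

* [LeeSmoothManifolds2013] J. M. Lee, *Introduction to Smooth Manifolds*, 2nd ed., GTM 218,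
  Springer 2013, Thm. 4.5, Prop. 4.6, Prop. 4.8, Thm. 4.14, Thm. 4.29.
-/

noncomputable section

open scoped Manifold ContDiff Topology ENNReal NNReal ContinuousMap
open Set Function

namespace Summit.SmoothPoincare4.SmoothPoincare4.Theorems.SubcylindricalRecognition.AncientSphereRigidity

section General

variable {E : Type*} [NormedAddCommGroup E] [NormedSpace ℝ E] [FiniteDimensional ℝ E]
  {H : Type*} [TopologicalSpace H] {I : ModelWithCorners ℝ E H} [I.Boundaryless]
  {N : Type*} [TopologicalSpace N] [ChartedSpace H N]
  {E' : Type*} [NormedAddCommGroup E'] [NormedSpace ℝ E'] [FiniteDimensional ℝ E']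
  {H' : Type*} [TopologicalSpace H'] {J : ModelWithCorners ℝ E' H'} [J.Boundaryless]
  {M : Type*} [TopologicalSpace M] [ChartedSpace H' M] {n : WithTop ℕ∞}

/-- **An equidimensional `C^n` immersion is a local diffeomorphism** (`1 ≤ n`, boundaryless
manifolds of the same finite dimension): pointwise the tree's inverse function theorem
`Literature.Topology.FourManifolds.isLocalDiffeomorphAt_of_mfderiv_injective` on the open set
`univ`. [cite: LeeSmoothManifolds2013, Thm. 4.5 and Prop. 4.8] -/
theorem isLocalDiffeomorph_of_contMDiff_of_injective_mfderiv [IsManifold I n N]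
    [IsManifold J n M] {φ : N → M} (hφ : ContMDiff I J n φ) (hn : 1 ≤ n)
    (hdim : Module.finrank ℝ E = Module.finrank ℝ E')
    (himm : ∀ x : N, Function.Injective (mfderiv I J φ x)) : IsLocalDiffeomorph I J n φ :=
  fun x ↦ Literature.Topology.FourManifolds.isLocalDiffeomorphAt_of_mfderiv_injective
    isOpen_univ (mem_univ x) hφ.contMDiffOn hn hdim (himm x)

omit [FiniteDimensional ℝ E] [I.Boundaryless] [ChartedSpace H N] [FiniteDimensional ℝ E']
  [J.Boundaryless] [ChartedSpace H' M] in
/-- **A continuous open map from a non-empty compact space to a connected Hausdorff space is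
surjective**: its range is open, compact hence closed, and non-empty, hence everything
(`IsClopen.eq_univ`). [cite: LeeSmoothManifolds2013, Thm. 4.29 (proof)] -/
theorem surjective_of_isOpenMap_of_compactSpace [CompactSpace N] [Nonempty N] [T2Space M]
    [ConnectedSpace M] {φ : N → M} (hcont : Continuous φ) (hopen : IsOpenMap φ) :
    Function.Surjective φ := by
  have hclopen : IsClopen (range φ) :=
    ⟨(isCompact_range hcont).isClosed, hopen.isOpen_range⟩
  exact Set.range_eq_univ.mp (hclopen.eq_univ (Set.range_nonempty φ))

/-- **An injective equidimensional immersion of a non-empty closed manifold into a connected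
manifold is a diffeomorphism** (model-agnostic form of `stub_compactModelRecognition`): a local
diffeomorphism by `isLocalDiffeomorph_of_contMDiff_of_injective_mfderiv`, surjective by
`surjective_of_isOpenMap_of_compactSpace`, then Mathlib's
`IsLocalDiffeomorph.diffeomorphOfBijective`.
[cite: LeeSmoothManifolds2013, Prop. 4.6, Prop. 4.8 and Thm. 4.29] -/
theorem nonempty_diffeomorph_of_injective_immersion [IsManifold I n N] [IsManifold J n M]
    [CompactSpace N] [Nonempty N] [T2Space M] [ConnectedSpace M] {φ : N → M}
    (hφ : ContMDiff I J n φ) (hn : 1 ≤ n) (hdim : Module.finrank ℝ E = Module.finrank ℝ E')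
    (hinj : Function.Injective φ) (himm : ∀ x : N, Function.Injective (mfderiv I J φ x)) :
    Nonempty (N ≃ₘ^n⟮I, J⟯ M) := by
  have hloc : IsLocalDiffeomorph I J n φ :=
    isLocalDiffeomorph_of_contMDiff_of_injective_mfderiv hφ hn hdim himm
  have hsurj : Function.Surjective φ :=
    surjective_of_isOpenMap_of_compactSpace hφ.continuous hloc.isOpenMap
  exact ⟨hloc.diffeomorphOfBijective ⟨hinj, hsurj⟩⟩

end General

/-- **Compact-model recognition** (registered stub `stub_compactModelRecognition` of line
`ancient-sphere-rigidity`; shared verbatim with line `spineless-models`): an injective `C^∞`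
immersion `φ : N → M` of a non-empty compact `4`-manifold into a connected `4`-manifold (both
modelled on `EuclideanSpace ℝ (Fin 4)`, boundaryless) is a diffeomorphism, `N ≃ₘ⟮𝓡 4, 𝓡 4⟯ M`
(`nonempty_diffeomorph_of_injective_immersion` with equal model dimensions).
[cite: LeeSmoothManifolds2013, Thm. 4.29, Prop. 4.8 and Thm. 4.14] -/
theorem stub_compactModelRecognition :
    ∀ (N M : Type) [TopologicalSpace N] [T2Space N] [SecondCountableTopology N]
      [ChartedSpace (EuclideanSpace ℝ (Fin 4)) N] [IsManifold (𝓡 4) ∞ N] [CompactSpace N] [Nonempty N]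
      [TopologicalSpace M] [T2Space M] [SecondCountableTopology M]
      [ChartedSpace (EuclideanSpace ℝ (Fin 4)) M] [IsManifold (𝓡 4) ∞ M] [ConnectedSpace M]
      (φ : N → M), ContMDiff (𝓡 4) (𝓡 4) ∞ φ → Function.Injective φ →
      (∀ x : N, Function.Injective (mfderiv (𝓡 4) (𝓡 4) φ x)) →
      Nonempty (N ≃ₘ⟮𝓡 4, 𝓡 4⟯ M) := by
  intro N M _ _ _ _ _ _ _ _ _ _ _ _ _ φ hφ hinj himm
  exact nonempty_diffeomorph_of_injective_immersion hφ (by exact_mod_cast le_top) rfl hinj himm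

end Summit.SmoothPoincare4.SmoothPoincare4.Theorems.SubcylindricalRecognition.AncientSphereRigidity
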